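import Summits.Ventures.HodgeRepro2.T5SU11IwasawaHaar
import Summits.Ventures.HodgeRepro2.T5SU11CoefficientL2

/-!
# The Haar measure of `SU(1,1)` as the push-forward of `e^{-2t} ds dt dk` under the Iwasawa map

`T5SU11IwasawaHaar` gives the integral formula `∫_G F dν = ∫_ℂ e^{-2 Im ζ} ∫_K F (n_s a_t k) dk dζ`.
Here it is stated as an equality of measures: with the Iwasawa coordinate map
`Ψ (ζ, k) = n_{Re ζ} a_{Im ζ} k` — a measurable BIJECTION `ℂ × K → SU(1,1)` (`iwasawa_bijective`) —
and the measure `e^{-2 Im ζ} dζ` on `ℂ = ℝ²` (`iwasawaDensity`),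
`ν = Ψ_* (iwasawaDensity ⊗ μ_K)` (`nu_eq_map_iwasawa`), hence every Haar measure of `SU(1,1)` is a
positive multiple of `Ψ_* (e^{-2t} ds dt ⊗ μ_K)` (`haar_eq_smul_map_iwasawa`) and Rühl's measure is
`μ_R = π⁻¹ Ψ_* (e^{-2t} ds dt ⊗ μ_K)` (`ruhl_eq_map_iwasawa`). Nothing is claimed about (N).

Blind lane: Mathlib + the HodgeRepro2 prefix only; no sorry; axioms ⊆ {propext, Classical.choice,
Quot.sound}.
-/

namespace Summit.Ventures.HodgeRepro2.T5SU11IwasawaMeasure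

open MeasureTheory MeasureTheory.Measure Metric Filter Topology Set Complex
open T5UnitaryBound T5PoincareDensity T5PoincareInvariance T5PoincareMeasure T5SU11Unimodular
  T5SU11Fibration T5SU11FibrationHaar T5SU11Cartan T5SU11OneParameter T5BergmanCoefficient
  T5SU11HyperbolicSubgroup T5SU11UnipotentSubgroup T5SU11BorelSubgroup T5SU11Iwasawa
  T5SU11IwasawaUnique T5SU11BorelTransitive T5SU11IwasawaHaar T5HaarCircle T5SU11CoefficientL2
open scoped ENNReal NNReal Real

/-! ### The Iwasawa coordinate map and the density `e^{-2t} ds dt` -/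

/-- The Iwasawa coordinate map `Ψ (ζ, k) = n_{Re ζ} a_{Im ζ} k` (`ζ = s + i t`). -/
noncomputable def iwasawa (p : ℂ × Circle) : SU11 := unip p.1.re * hyp p.1.im * rot p.2

/-- The measure `e^{-2 Im ζ} dζ` on `ℂ = ℝ²`, i.e. `e^{-2t} ds dt`. -/
noncomputable def iwasawaDensity : Measure ℂ :=
  volume.withDensity fun ζ => ENNReal.ofReal (Real.exp (-(2 * ζ.im)))

/-- `Ψ (ζ, k) = n_{Re ζ} a_{Im ζ} k`. -/
lemma iwasawa_apply (ζ : ℂ) (u : Circle) : iwasawa (ζ, u) = unip ζ.re * hyp ζ.im * rot u := rfl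

/-- `Ψ` is continuous. -/
lemma continuous_iwasawa : Continuous iwasawa :=
  ((continuous_unip.comp (Complex.continuous_re.comp continuous_fst)).mul
    (continuous_hyp.comp (Complex.continuous_im.comp continuous_fst))).mul
    (continuous_rot.comp continuous_snd)

/-- **`Ψ` is a bijection `ℂ × K → SU(1,1)`** (the Iwasawa decomposition `N A K` with its uniqueness,
`T5SU11IwasawaUnique`). -/
theorem iwasawa_bijective : Function.Bijective iwasawa := by
  constructor
  · rintro ⟨ζ, u⟩ ⟨ζ', u'⟩ h
    obtain ⟨hs, ht, hu⟩ := iwasawa_unique h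
    rw [Prod.mk.injEq]
    exact ⟨Complex.ext hs ht, hu⟩
  · intro g
    obtain ⟨s, t, u, h⟩ := exists_unip_mul_hyp_mul_rot g
    exact ⟨(⟨s, t⟩, u), h.symm⟩

/-- The density `e^{-2t}` is measurable. -/
lemma measurable_iwasawaDensityFun :
    Measurable fun ζ : ℂ => ENNReal.ofReal (Real.exp (-(2 * ζ.im))) := by
  fun_prop

/-- `iwasawaDensity` is σ-finite. -/
instance instSigmaFiniteIwasawaDensity : SigmaFinite iwasawaDensity := by
  unfold iwasawaDensity
  exact SigmaFinite.withDensity_ofReal _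

section measure

variable [MeasurableSpace Circle] [BorelSpace Circle] (μC : Measure Circle) [IsHaarMeasure μC]

/-- `Ψ` is measurable. -/
lemma measurable_iwasawa : Measurable iwasawa := continuous_iwasawa.measurable

/-- **THE HAAR MEASURE `ν` IS `Ψ_* (e^{-2t} ds dt ⊗ μ_K)`**: the measure `ν = Φ_*(poincare ⊗ μ_K)`
of `T5SU11FibrationHaar` is the push-forward of `iwasawaDensity ⊗ μ_K` under the Iwasawa map. -/
theorem nu_eq_map_iwasawa : nu μC = map iwasawa (iwasawaDensity.prod μC) := by
  ext S hS
  have hpre : MeasurableSet (iwasawa ⁻¹' S) := measurable_iwasawa hS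
  rw [map_apply measurable_iwasawa hS, Measure.prod_apply hpre, iwasawaDensity,
    lintegral_withDensity_eq_lintegral_mul _ measurable_iwasawaDensityFun
      (measurable_measure_prodMk_left hpre),
    ← lintegral_indicator_one hS, lintegral_nu μC (S.indicator 1) (measurable_one.indicator hS)]
  refine lintegral_congr fun ζ => ?_
  simp only [Pi.mul_apply]
  congr 1
  have hT : MeasurableSet {u : Circle | unip ζ.re * hyp ζ.im * rot u ∈ S} :=
    (measurable_iwasawa.comp measurable_prodMk_left) hS
  show ∫⁻ u, S.indicator 1 (unip ζ.re * hyp ζ.im * rot u) ∂μC =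
    μC {u : Circle | unip ζ.re * hyp ζ.im * rot u ∈ S}
  rw [← lintegral_indicator_one hT]
  refine lintegral_congr fun u => ?_
  by_cases h : unip ζ.re * hyp ζ.im * rot u ∈ S
  · simp [h]
  · simp [h]

/-- **Every Haar measure of `SU(1,1)` is a positive multiple of `Ψ_* (e^{-2t} ds dt ⊗ μ_K)`**:
`μ = c⁻¹ • Ψ_* (iwasawaDensity ⊗ μ_K)` with `c = haarScalarFactor ν μ > 0`. -/
theorem haar_eq_smul_map_iwasawa (μ : Measure SU11) [IsHaarMeasure μ] :
    μ = ((haarScalarFactor (nu μC) μ : ℝ≥0∞)⁻¹) • map iwasawa (iwasawaDensity.prod μC) := by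
  set c := haarScalarFactor (nu μC) μ with hc
  have hc0 : (c : ℝ≥0∞) ≠ 0 := ENNReal.coe_ne_zero.mpr (haarScalarFactor_nu_pos μC μ).ne'
  rw [← nu_eq_map_iwasawa, nu_eq_smul μC μ, ← hc, ENNReal.smul_def, smul_smul,
    ENNReal.inv_mul_cancel hc0 ENNReal.coe_ne_top, one_smul]

/-- **Rühl's measure is `π⁻¹ Ψ_* (e^{-2t} ds dt ⊗ μ_K)`.** -/
theorem ruhl_eq_map_iwasawa :
    ruhl = ENNReal.ofReal π⁻¹ • map iwasawa (iwasawaDensity.prod haarCircle) := by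
  rw [ruhl, nu_eq_map_iwasawa]

end measure

end Summit.Ventures.HodgeRepro2.T5SU11IwasawaMeasure
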